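import Summits.QuantumFields.BalabanUV.T4Continuum.Support.ShellMeasureLinearizedChart
import Summits.QuantumFields.BalabanUV.T4Continuum.Support.ShellMeasureLinearizedJacobianFixed
import Mathlib.Analysis.Calculus.FDeriv.Measurable

/-!
# `T4Continuum.ShellMeasureLinearizedEndFromQ` — (LR)_j: THE END OF RECORD COMPOSED — the curved chart BUILT from the
# average-in-the-chart `Q̃` (row S46) and the JACOBIAN of print's linearizing substitution INTERNALISED as one more
# non-Wilson term whose E2′ ray binder is a THEOREM (row S41); the dictionary is asked of the block DENSITY ALONE
(cell `pub-balaban`, sub-cell `t4`, spine estimate NE7c (node U5b); NE7c ROUND-2 crew seat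
`b2b-balaban-t4-ne7c-formalise-leaf-02` gen 7 — idle-seat OFFER in the S36∕S41 orbit (journal `CLAIMS.log`
«THE (LR)_j END OF RECORD COMPOSED: CURVED CHART FROM Q̃, JACOBIAN TERM INTERNALISED»); ADDITIVE — imports S33 f1
`ShellMeasureLinearizedChart` (p216580, leaf-09-g7) and S41 f3 `ShellMeasureLinearizedJacobianFixed` (p218962; hence
S41 f2, S46 `ShellMeasureLinearizedFromQ` p218633 (leaf-08-g10), S40 `ShellMeasureLinearizedRealStructure` p217266
(leaf-09-g8)) + Mathlib's `FDeriv.Measurable` only, modifies nothing; [folklore] measure theory BY NAME over tree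
theorems; 0 `def`, 0 `def … : Prop`, 0 sorry, 0 citations)

HONEST FRAMING.  Finite four-torus programme, rung (B)+1 only — NOT infinite volume, NOT a mass gap, NOT the Clay
problem, NOT summit progress; (B), `BetaPertHyp`, (B^μ) not consumed.  NE7c (`T4IndicatorShell.ShellWeightBound`) is
NOT PRINTED and NOT PROVED; «NE7c ⇐ the named binders» (trigger c3).  Nothing of [Balaban 1983–89] is asserted: the
average-in-the-chart `Q̃` enters hypothesis-style through S46's (Q1)–(Q4) + `hop` + `D̃` binder block (KERNEL for the
PRINTED one-step average (15) by rows S47–S51, WALL v1.4 §3 — NOT imported, NOT claimed here); (M1) for Bałaban's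
inductively defined measures is NOT PRINTED (GAPS G-ne7cp1-1); SM-L1∕L3∕L4 for Bałaban's OWN terms, SM-L5∕L6 and the
[dict] identification stay DISPLAYED binders.  HONEST DEPENDENCY (cell, verbatim): continuum YM on T⁴ ⇐ BetaPertH ∧
nine spine estimates (0/9 proved); BetaPertH ⇐ (D1) ∧ (D4) ∧ CAP+tail; G-an2-4 gates asym, D1 and NE2/3/4.

THE POINT.  The (LR)_j END OF RECORD (RULING T-NE7c-8) `ShellMeasureLinearizedChart.slotAC_linearizedWindow_of_levelData`
takes, per exterior point `z`, the curved chart `(O z, Φ z, Φ' z)` and the PULLED-BACK density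
`Gt z = 1_{O z}·|det Φ' z|·G(Φ z ·, z)` as FREE binders, the Jacobian `|det Φ'|` riding INSIDE the dictionary binder
`hFdict` («as the supplier decides»).  The chart-data suppliers (S35∕S36∕S40∕S46∕S50∕S51) produce its `hΦm`∕`hinj`∕`hΦ'`
for one exterior point, S41 produces the Jacobian term's E2′ ray binder — but no tree theorem CALLED the END with them.
This file does, ONCE, for exterior-indexed `Q̃`-data with UNIFORM constants:
* §1 pointwise Jacobian facts on the constructed real form `Fix(κ_𝒴)` from `Q̃`'s data: the real Jacobian
  `det Φ'_ℝ(B) = det (id − h ∘ (reP κ_𝒳 ∘ DD̃(B)↾ℝ ∘ incl κ_𝒴))` is POSITIVE on the window (`det_jacobian_pos_of_Q`, S41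
  BY NAME), BOUNDED by `exp (dim_ℂ 𝒴 · (−log(1 − 18·(2M_Q∕R²)·b·r)))` at `‖B‖ ≤ r < ε` (`det_jacobian_le_exp_of_Q`, S41
  `det_realForm_phi_eq_exp` + `B12JacobianTrLog268.norm_trace_logJacobian_le_finrank`), and MEASURABLE in `B`
  (`measurable_det_jacobian`: Mathlib `measurable_fderiv` + continuity of `det`); the Boltzmann weight splits a sum of
  terms (`weight_add`).
* §2 **`slotAC_linearizedWindow_of_Q`** — S33 f1's END on the block space `E := Fix(κ_𝒴)` (S40 `realSub κY`, Lebesgue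
  `μE`), average space `F := Fix(κ_𝒳)`, with: (α) the chart `Φ z` = S46's real substitution
  `B ↦ B − h_z (1_{‖·‖<ε}·reP κ_𝒳 (D̃_z (incl B)))`, given by its defining equation `hΦ` (consumer: `fun _ => rfl`),
  its `hO`∕`hΦm`∕`hinj`∕`hΦ'` DISCHARGED by S46 `realForm_chartData_of_Q` per `z`; (β) the binders `Gt`∕`hGtm`∕`hGt`
  GONE (built inside, measurability proved); (γ) the DICTIONARY asked of the DENSITY ALONE —
  `hFdict : 1_{window}·G(Φ z ·, z)` at the charted point `σ z a + Ψ z (x, 0)` `= Jco z a x * weight … (𝓔 z a) x` with NO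
  Jacobian factor, `hudict` guarded by the same Jacobian-free quantity; inside, `|det Φ' z| = det Φ' z = e^{−𝓔_J}` and
  the JACOBIAN TERM `𝓔_J z a x := −log det Φ'_z(σ z a + Ψ z (x, 0))` (print's (2.12) «Tr log(I − h δ∕δB D̃)») is ADDED
  to the term family; (δ) `hfin` asked of the density alone through the chart (the Jacobian is bounded on the
  charted window, §1); (ε) `hE`∕`hB𝓔` asked for the OTHER terms `𝓔` only — the Jacobian's ray binder is S41 f3
  `hE_jacobianTerm_fixed_of_Q` with `Λ x := Ψ z (x, 0)`, `y₀ := σ z a`, under ONE window-placement hypothesis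
  `hWr : ‖σ z a‖ + Rad·‖Ψ z (x, 0)‖ ≤ r` on `W z a`, `0 ≤ r < ε`; (ζ) SM-L1∕L3∕L5∕L6 binders and numbers = S33's
  token for token.  CONCLUSION = S33 f1's LITERALLY with `B_𝓔 + B_J`,
  `B_J := 3·(2·dim_ℂ 𝒴·(−log(1 − 18·(2M_Q∕R²)·b·r)))∕(Rad − 1)`.  Empty exterior space: the sectioned (M1) is vacuous
  (`T4ShellMeasureLocal.slotAntiConcentration_of_sections`).
WHICH END ∕ BINDER.  It IS the (LR)_j END of record with W-d's analytic half CONSUMED BY NAME ((Q1)–(Q4) + `hop` + `D̃`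
— the S52 assembly's input block instantiates it for (15), one call, if the owner wants it; a germ (Q4) converts by
`ShellMeasureEquivariantGerm.conj_eqOn_ball_of_eventually`, S51) and the Jacobian's share of W-b∕W-c REMOVED from the
supplier's list: after it a live slot on this road asks the [dict] identification `hFdict`∕`hudict`∕`hGsupp` of the
DENSITY and the classifier at the charted point (node O — no Jacobian bookkeeping left), SM-L1∕L3∕L4 for Bałaban's
own terms (W-a∕W-b), SM-L5∕L6 (W-e), numbers∕(SM), and `Ψ`∕`σ` (S50 f1 `exists_realForm_kerSplit`).  Mints nothing
(c2); NOT an instance of SM-L1…L6 for Bałaban's measures; NOTHING in the countdown moves; NE7c NOT PROVED; 0/9.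
-/

noncomputable section

open Set Function MeasureTheory MeasureTheory.Measure Metric Filter Topology

namespace Summit.QuantumFields.BalabanUV.T4Continuum.ShellMeasureLinearizedEndFromQ

open scoped ENNReal NNReal
open Literature.MathematicalPhysics.QuantumFieldTheory.Balaban1983to89
open T4ShellMeasure (SlotAntiConcentration)
open T4ShellMeasureLocal (slotAntiConcentration_of_sections)
open B12JacobianTrLog268 (eighteen_lt_one lt_one_of_le_half norm_trace_logJacobian_le_finrank)
open ShellMeasureWilsonTrace (TraceData)
open ShellMeasureWilsonMoving (MLetter mwordEval mdFro sSum lSum)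
open ShellMeasureLevelAssembly (classifier action weight)
open Summit.QuantumFields.BalabanUV.Beta.LinearizingChange267FromQ (nonlin Mq)
open ShellMeasureLinearizedRealStructure (realSub incl reP conj_incl incl_reP_of_fixed reP_incl norm_incl)
open ShellMeasureLinearizedFromQ (realForm_chartData_of_Q quadAnalytic_nonlin_of_Q analyticOnNhd_nonlin_of_Q
  Mq_nonneg_of_Q nonlin_conj_of_equivariant)
open ShellMeasureLinearizedJacobian (hop_ιF_realForm det_realForm_phi_eq_exp hB𝓔_jacobianTerm)
open ShellMeasureLinearizedJacobianFixed (det_realForm_phi_pos_of_Q hE_jacobianTerm_fixed_of_Q)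
open ShellMeasureLinearizedChart (slotAC_linearizedWindow_of_levelData)

variable {𝒳 𝒴 : Type*} [NormedAddCommGroup 𝒳] [NormedSpace ℂ 𝒳] [CompleteSpace 𝒳]
  [NormedAddCommGroup 𝒴] [NormedSpace ℂ 𝒴] [CompleteSpace 𝒴] [FiniteDimensional ℂ 𝒴]
  {κX : 𝒳 ≃ₗᵢ⋆[ℂ] 𝒳} {κY : 𝒴 ≃ₗᵢ⋆[ℂ] 𝒴}
  {Qt : 𝒴 → 𝒳} {hop : 𝒳 →ₗ[ℂ] 𝒴} {Dt : 𝒴 → 𝒳} {R MQ b ε : ℝ}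

/-! ## §1 Pointwise Jacobian facts on `Fix(κ_𝒴)` from `Q̃`'s data -/

/-- **THE REAL JACOBIAN IS POSITIVE ON THE WINDOW, FROM `Q̃`**: for `B ∈ Fix(κ_𝒴)` with `‖B‖ < ε`,
`0 < det (id − h ∘ (reP κ_𝒳 ∘ DD̃(B)↾ℝ ∘ incl κ_𝒴))`, `h := reP κ_𝒴 ∘ hop↾ℝ ∘ incl κ_𝒳` — S41
`det_realForm_phi_pos_of_Q` with the real form of S40 (`incl_reP_of_fixed`, `conj_incl`, `reP_incl`,
`hop_ιF_realForm` BY NAME). [folklore] -/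
theorem det_jacobian_pos_of_Q (hκX : ∀ X, κX (κX X) = X) (hκY : ∀ B, κY (κY B) = B)
    (hR : 0 < R) (hQa : AnalyticOnNhd ℂ Qt (ball 0 R)) (hQM : ∀ B ∈ ball (0 : 𝒴) R, ‖Qt B‖ ≤ MQ)
    (hQ0 : Qt 0 = 0) (hb : 0 ≤ b) (hHop : ∀ X, ‖hop X‖ ≤ b * ‖X‖) (hq2 : 9 * Mq R MQ * b * ε ≤ 1 / 2)
    (hRC : 3 * ε ≤ R) (hDball : ∀ B : 𝒴, ‖B‖ < ε → Dt B ∈ closedBall (0 : 𝒳) (4 * Mq R MQ * ε ^ 2))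
    (hDfix : ∀ B : 𝒴, ‖B‖ < ε → nonlin Qt (B - hop (Dt B)) = Dt B)
    (hhop : ∀ X, hop (κX X) = κY (hop X)) (hQt : ∀ B ∈ ball (0 : 𝒴) R, Qt (κY B) = κX (Qt B))
    {B : realSub κY} (hB : ‖incl κY B‖ < ε) :
    0 < (ContinuousLinearMap.id ℝ (realSub κY) -
      (reP κY hκY ∘L (hop.mkContinuous b hHop).restrictScalars ℝ ∘L incl κX) ∘L
        (reP κX hκX ∘L (fderiv ℂ Dt (incl κY B)).restrictScalars ℝ ∘L incl κY)).det :=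
  det_realForm_phi_pos_of_Q hR hQa hQM hQ0 hb hHop hq2 hRC hDball hDfix hκX hκY hhop hQt (incl_reP_of_fixed hκY)
    (conj_incl κY) (reP_incl hκY) (incl_reP_of_fixed hκX)
    (hop_ιF_realForm hHop hhop (incl_reP_of_fixed hκY) (conj_incl κX)) hB

/-- **THE REAL JACOBIAN IS BOUNDED ON THE CHARTED WINDOW, FROM `Q̃`**: for `B ∈ Fix(κ_𝒴)` with `‖B‖ ≤ r < ε`,
`det Φ'_ℝ(B) ≤ exp (dim_ℂ 𝒴 · (−log(1 − 18·(2M_Q∕R²)·b·r)))` — S41 `det_realForm_phi_eq_exp` (`det = e^{Re Tr mlog(1−J)}`)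
+ `B12JacobianTrLog268.norm_trace_logJacobian_le_finrank` + monotonicity of `−log(1 − ·)`. [folklore] -/
theorem det_jacobian_le_exp_of_Q (hκX : ∀ X, κX (κX X) = X) (hκY : ∀ B, κY (κY B) = B)
    (hR : 0 < R) (hQa : AnalyticOnNhd ℂ Qt (ball 0 R)) (hQM : ∀ B ∈ ball (0 : 𝒴) R, ‖Qt B‖ ≤ MQ)
    (hQ0 : Qt 0 = 0) (hb : 0 ≤ b) (hHop : ∀ X, ‖hop X‖ ≤ b * ‖X‖) (hq2 : 9 * Mq R MQ * b * ε ≤ 1 / 2)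
    (hRC : 3 * ε ≤ R) (hDball : ∀ B : 𝒴, ‖B‖ < ε → Dt B ∈ closedBall (0 : 𝒳) (4 * Mq R MQ * ε ^ 2))
    (hDfix : ∀ B : 𝒴, ‖B‖ < ε → nonlin Qt (B - hop (Dt B)) = Dt B)
    (hhop : ∀ X, hop (κX X) = κY (hop X)) (hQt : ∀ B ∈ ball (0 : 𝒴) R, Qt (κY B) = κX (Qt B))
    {B : realSub κY} {r : ℝ} (hBr : ‖incl κY B‖ ≤ r) (hrε : r < ε) :
    (ContinuousLinearMap.id ℝ (realSub κY) -
      (reP κY hκY ∘L (hop.mkContinuous b hHop).restrictScalars ℝ ∘L incl κX) ∘L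
        (reP κX hκX ∘L (fderiv ℂ Dt (incl κY B)).restrictScalars ℝ ∘L incl κY)).det ≤
      Real.exp (Module.finrank ℂ 𝒴 * (-Real.log (1 - 18 * Mq R MQ * b * r))) := by
  have hB : ‖incl κY B‖ < ε := hBr.trans_lt hrε
  have hC := quadAnalytic_nonlin_of_Q hR hQa hQM hQ0
  have hCa := analyticOnNhd_nonlin_of_Q hQa
  have hC₂ := Mq_nonneg_of_Q hR hQM
  have hCt := nonlin_conj_of_equivariant hR hQa hQt
  rw [det_realForm_phi_eq_exp hC hCa hC₂ hb hHop hq2 hRC hDball hDfix hκX hκY hhop hCt (incl_reP_of_fixed hκY)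
    (conj_incl κY) (reP_incl hκY) (incl_reP_of_fixed hκX)
    (hop_ιF_realForm hHop hhop (incl_reP_of_fixed hκY) (conj_incl κX)) hB, Real.exp_le_exp]
  refine (Complex.re_le_norm _).trans
    ((norm_trace_logJacobian_le_finrank hC hCa hC₂ hb hHop hq2 hRC hDball hDfix hB).trans ?_)
  refine mul_le_mul_of_nonneg_left (neg_le_neg (Real.log_le_log ?_ ?_)) (Nat.cast_nonneg _)
  · linarith [eighteen_lt_one hC₂ hb hq2 hrε]
  · have : 0 ≤ 18 * Mq R MQ * b := by positivity
    nlinarith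

omit [CompleteSpace 𝒴] [FiniteDimensional ℂ 𝒴] in
/-- **THE REAL JACOBIAN IS MEASURABLE IN THE POINT** — the derivative `DD̃` of ANY map is Borel measurable (Mathlib
`measurable_fderiv`), the real-form sandwich is continuous linear in it, `det` is continuous. [folklore] -/
theorem measurable_det_jacobian [MeasurableSpace 𝒴] [BorelSpace 𝒴]
    (hκX : ∀ X, κX (κX X) = X) (hκY : ∀ B, κY (κY B) = B) (hHop : ∀ X, ‖hop X‖ ≤ b * ‖X‖) (Dt : 𝒴 → 𝒳) :
    Measurable fun B : realSub κY => (ContinuousLinearMap.id ℝ (realSub κY) -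
      (reP κY hκY ∘L (hop.mkContinuous b hHop).restrictScalars ℝ ∘L incl κX) ∘L
        (reP κX hκX ∘L (fderiv ℂ Dt (incl κY B)).restrictScalars ℝ ∘L incl κY)).det := by
  have h1 : Measurable fun B : realSub κY => fderiv ℂ Dt (incl κY B) :=
    (measurable_fderiv ℂ Dt).comp (incl κY).continuous.measurable
  have h2 : Continuous fun T : 𝒴 →L[ℂ] 𝒳 => ContinuousLinearMap.id ℝ (realSub κY) -
      (reP κY hκY ∘L (hop.mkContinuous b hHop).restrictScalars ℝ ∘L incl κX) ∘L
        (reP κX hκX ∘L T.restrictScalars ℝ ∘L incl κY) :=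
    continuous_const.sub (continuous_const.clm_comp (continuous_const.clm_comp
      ((ContinuousLinearMap.continuous_restrictScalars (𝕜 := ℂ) (E := 𝒴) (F := 𝒳) ℝ).clm_comp
        continuous_const)))
  exact (ContinuousLinearMap.continuous_det.comp h2).measurable.comp h1

omit [CompleteSpace 𝒳] [CompleteSpace 𝒴] [FiniteDimensional ℂ 𝒴] in
/-- the Boltzmann weight of a SUM of non-Wilson terms splits off the factor `e^{−𝓔₂}`. [folklore] -/
theorem weight_add {Kf A : Type*} [NormedAddCommGroup Kf] [NormedSpace ℝ Kf] [NormedRing A] [NormedAlgebra ℂ A]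
    (T : TraceData A) (β : ℝ) {κ : Type*} (Pw : Finset κ) (Gw : κ → Kf → A) (𝓔₁ 𝓔₂ : Kf → ℝ) (x : Kf) :
    weight T β Pw Gw (fun x => 𝓔₁ x + 𝓔₂ x) x = weight T β Pw Gw 𝓔₁ x * ENNReal.ofReal (Real.exp (-𝓔₂ x)) := by
  simp only [weight, action]
  rw [← add_assoc, neg_add, Real.exp_add, ENNReal.ofReal_mul (Real.exp_pos _).le]

/-! ## §2 The END of record, composed -/

variable [FiniteDimensional ℂ 𝒳] [MeasurableSpace 𝒴] [BorelSpace 𝒴] [MeasurableSpace 𝒳] [BorelSpace 𝒳]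

/-- **THE (LR)_j END OF RECORD WITH THE CURVED CHART FROM `Q̃` AND THE JACOBIAN TERM INTERNALISED.**
DATA.  Involutive conjugations `κ_𝒳`, `κ_𝒴` of the complexified average∕block spaces (finite dimension); the block
space IS the real form `Fix(κ_𝒴)` (Lebesgue `μE`), the average space `Fix(κ_𝒳)`; a fibre model `Kf` (`μK`); any
exterior space `Z` (s-finite `ζ`).  PER EXTERIOR POINT `z`, with UNIFORM constants `R, M_Q, b, ε`: the
average-in-the-chart `Qt z` — (Q1) analytic on `ball 0 R`, (Q2) `= 0` at `0`, (Q3) `‖·‖ ≤ M_Q` there, (Q4)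
⋆-equivariant —, a right inverse `hop z` of `DQ̃_z(0)` («LQ̃h = I») with `‖hop z X‖ ≤ b‖X‖`, equivariant; the
couplings `9·(2M_Q∕R²)·b·ε ≤ 1∕2`, `3ε ≤ R`; a solution `Dt z` of print's fixed-point equation on `‖B‖ < ε` (exists:
S46 `exists_Dt_of_Q`); a splitting `Ψ z : Kf × Fix κ_𝒳 ≃ Fix κ_𝒴` whose second coordinate is the REAL `LQ̃_z` and a
measurable section `σ z` (exist: S50 `exists_realForm_kerSplit`); the CHART `Φ z` by its defining equation `hΦ`.
THE SLOT.  The realized law `((μE.prod ζ).withDensity G)` with measurable density `G` SUPPORTED in the chart image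
of the window, a measurable tested variable `u`; `hfin`: finite fibre mass of the density through the chart.
LEVEL DATA per `(z, a)` in the fibre coordinate (E2′'s) and the DICTIONARY OF THE DENSITY ALONE: `hFdict` — the
window-restricted density at the charted point `σ z a + Ψ z (x, 0)` IS `Jco z a x · weight(… 𝓔 z a) x` (NO Jacobian
factor); `hudict` — the tested variable at the image point IS the classifier, on the support; window placement
`hWr`; SM-L5∕L6 `hJW`∕`hJ`; SM-L1 `hAN`; SM-L3 `hGW`; SM-L4 `hE`∕`hB𝓔` FOR THE TERMS `𝓔` ONLY; numbers + (SM).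
CONCLUSION: S33 f1's `SlotAntiConcentration ((μE.prod ζ).withDensity G) u θ ρ (2(finrank ℝ Kf + β Σ_p L̄_p(d̄_p +
4s̄_p) + (B_𝓔 + B_J))∕(1−δ))`, `B_J = 3·(2·dim_ℂ 𝒴·(−log(1 − 18·(2M_Q∕R²)·b·r)))∕(Rad − 1)` — the Jacobian of the
substitution is the internal term `𝓔_J := −log det Φ'` with its `hE` supplied by S41.  CONDITIONAL on every binder;
nothing PRINTED is asserted. [folklore] -/
theorem slotAC_linearizedWindow_of_Q (μE : Measure (realSub κY)) [μE.IsAddHaarMeasure]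
    {Kf : Type*} [NormedAddCommGroup Kf] [NormedSpace ℝ Kf] [MeasurableSpace Kf] [BorelSpace Kf]
    [FiniteDimensional ℝ Kf] (μK : Measure Kf) [μK.IsAddHaarMeasure]
    {A : Type*} [NormedRing A] [NormedAlgebra ℂ A] [CompleteSpace A] [NormOneClass A]
    (hκX : ∀ X, κX (κX X) = X) (hκY : ∀ B, κY (κY B) = B)
    {Z : Type*} [MeasurableSpace Z] (ζ : Measure Z) [SFinite ζ]
    -- W-d ANALYTIC HALF per exterior point, UNIFORM constants: (Q1)–(Q4), `hop`, `D̃`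
    {Qt : Z → 𝒴 → 𝒳} {hop : Z → (𝒳 →ₗ[ℂ] 𝒴)} {Dt : Z → 𝒴 → 𝒳} {R MQ b ε : ℝ}
    (hR : 0 < R) (hQa : ∀ z, AnalyticOnNhd ℂ (Qt z) (ball 0 R)) (hQ0 : ∀ z, Qt z 0 = 0)
    (hQM : ∀ z, ∀ B ∈ ball (0 : 𝒴) R, ‖Qt z B‖ ≤ MQ)
    (hQt : ∀ z, ∀ B ∈ ball (0 : 𝒴) R, Qt z (κY B) = κX (Qt z B))
    (hLQh : ∀ z X, fderiv ℂ (Qt z) 0 (hop z X) = X) (hb : 0 ≤ b) (hHop : ∀ z X, ‖hop z X‖ ≤ b * ‖X‖)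
    (hhop : ∀ z X, hop z (κX X) = κY (hop z X)) (hq2 : 9 * Mq R MQ * b * ε ≤ 1 / 2) (hRC : 3 * ε ≤ R)
    (hDball : ∀ z, ∀ B : 𝒴, ‖B‖ < ε → Dt z B ∈ closedBall (0 : 𝒳) (4 * Mq R MQ * ε ^ 2))
    (hDfix : ∀ z, ∀ B : 𝒴, ‖B‖ < ε → nonlin (Qt z) (B - hop z (Dt z B)) = Dt z B)
    -- the splitting along the REAL linearized average, and its section
    (Ψ : Z → (Kf × realSub κX) ≃L[ℝ] realSub κY)
    (hΨ : ∀ z y, ((Ψ z).symm y).2 = (reP κX hκX ∘L (fderiv ℂ (Qt z) 0).restrictScalars ℝ ∘L incl κY) y)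
    {σ : Z → realSub κX → realSub κY} (hσm : ∀ z, Measurable (σ z)) (hσ : ∀ z a, ((Ψ z).symm (σ z a)).2 = a)
    -- the chart: print's linearizing substitution read on the real form, BY ITS DEFINING EQUATION
    {Φ : Z → realSub κY → realSub κY}
    (hΦ : ∀ z, Φ z = fun B => B - (reP κY hκY ∘L ((hop z).mkContinuous b (hHop z)).restrictScalars ℝ ∘L incl κX)
      (({y : realSub κY | ‖incl κY y‖ < ε}).piecewise (fun y => reP κX hκX (Dt z (incl κY y))) 0 B))
    -- the realized slot law: block density SUPPORTED in the chart image of the window, tested variable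
    {G : realSub κY × Z → ℝ≥0∞} (hG : Measurable G) {u : realSub κY × Z → ℝ} (hu : Measurable u)
    (hGsupp : ∀ z y, G (y, z) ≠ 0 → y ∈ Φ z '' {y : realSub κY | ‖incl κY y‖ < ε})
    (hfin : ∀ z a, (μK.withDensity fun x => ({y : realSub κY | ‖incl κY y‖ < ε}).indicator
      (fun y => G (Φ z y, z)) (σ z a + Ψ z (x, 0))) univ ≠ ∞)
    -- level data per exterior point AND average value, in the fibre coordinate (E2′'s)
    (Ttr : TraceData A) (hN : 0 < Ttr.N) {ι κ : Type*} {Pu : Finset ι} (hPu : Pu.Nonempty)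
    (hol : Z → realSub κX → ι → Kf → A) (hcont : ∀ z a, ∀ p ∈ Pu, Continuous (hol z a p))
    (Pw : Finset κ) (Gw : Z → realSub κX → κ → Kf → A) (𝓔 : Z → realSub κX → Kf → ℝ)
    (W : Z → realSub κX → Set Kf) (Jco : Z → realSub κX → Kf → ℝ≥0∞) {θ δ ρ β Rad H B𝓔 r : ℝ}
    {sw lw dw : κ → ℝ}
    -- DICTIONARY at the charted point — the DENSITY ALONE, NO Jacobian factor
    (hFdict : ∀ z a x, ({y : realSub κY | ‖incl κY y‖ < ε}).indicator (fun y => G (Φ z y, z))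
      (σ z a + Ψ z (x, 0)) = Jco z a x * weight Ttr β Pw (Gw z a) (𝓔 z a) x)
    (hudict : ∀ z a x, ({y : realSub κY | ‖incl κY y‖ < ε}).indicator (fun y => G (Φ z y, z))
      (σ z a + Ψ z (x, 0)) ≠ 0 → u (Φ z (σ z a + Ψ z (x, 0)), z) = classifier hPu (hol z a) x)
    -- WINDOW PLACEMENT: the complexified rays of the window stay in the chart ball of radius `r < ε`
    (hWr : ∀ z a, ∀ x ∈ W z a, ‖σ z a‖ + Rad * ‖Ψ z (x, 0)‖ ≤ r) (hr0 : 0 ≤ r) (hrε : r < ε)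
    -- SM-L5/L6: kept co-tests supported in the window, centre-monotone
    (hJW : ∀ z a x, Jco z a x ≠ 0 → x ∈ W z a)
    (hJ : ∀ z a x, ∀ a' : ℝ, 0 ≤ a' → Jco z a x ≤ Jco z a (Real.exp (-a') • x))
    -- SM-L1 (AN-bound)
    (hRad : 1 < Rad)
    (hAN : ∀ z a, ∀ x ∈ W z a, ∀ p ∈ Pu, ∃ f : ℂ → A, DifferentiableOn ℂ f (ball 0 Rad) ∧
      (∀ w ∈ ball (0 : ℂ) Rad, ‖f w‖ ≤ H) ∧ f 0 = 0 ∧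
      ∀ c' : ℝ, 0 ≤ c' → c' ≤ 1 → f (c' : ℂ) = hol z a p (c' • x) - 1)
    -- SM-L3 graded sectioned words
    (hGW : ∀ z a, ∀ x ∈ W z a, ∀ p ∈ Pw, ∃ gw : List (MLetter A × ℝ × ℝ), (∀ y ∈ gw, y.1.Good Ttr.τ y.2.1 y.2.2) ∧
      sSum gw ≤ sw p ∧ lSum gw ≤ lw p ∧ mdFro (gw.map Prod.fst) ≤ dw p ∧
      ∀ c' : ℝ, 0 ≤ c' → c' ≤ 1 → mwordEval c' (gw.map Prod.fst) = Gw z a p (c' • x))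
    (hsw1 : ∀ p ∈ Pw, sw p ≤ 1) (hsw0 : ∀ p ∈ Pw, 0 ≤ sw p) (hlw0 : ∀ p ∈ Pw, 0 ≤ lw p)
    (hdw0 : ∀ p ∈ Pw, 0 ≤ dw p)
    -- SM-L4 non-Wilson ray bound FOR BAŁABAN'S OTHER TERMS ONLY (the Jacobian's is a theorem, S41)
    (hE : ∀ z a, ∀ x ∈ W z a, ∀ c' : ℝ, 1 / 2 ≤ c' → c' ≤ 1 → 𝓔 z a (c' • x) ≤ 𝓔 z a x + (1 - c') * B𝓔)
    (hB𝓔 : 0 ≤ B𝓔)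
    -- numbers + SM-L2 (SM)
    (hθ : 0 < θ) (hδ0 : 0 ≤ δ) (hδ1 : δ < 1) (hρ0 : 0 ≤ ρ) (hρ : ρ ≤ (1 - δ) / 2) (hβ : 0 ≤ β)
    (hSM : 36 * H * 1 ^ 2 / (Rad - 1) ^ 2 ≤ δ * θ) :
    SlotAntiConcentration ((μE.prod ζ).withDensity G) u θ ρ
      (2 * ((Module.finrank ℝ Kf : ℝ) + (β * ∑ p ∈ Pw, lw p * (dw p + 4 * sw p) +
        (B𝓔 + 3 * (2 * (Module.finrank ℂ 𝒴 * (-Real.log (1 - 18 * Mq R MQ * b * r)))) / (Rad - 1)))) /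
        (1 - δ)) := by
  -- empty exterior space: the sectioned (M1) is vacuous
  rcases isEmpty_or_nonempty Z with hZ | ⟨⟨z₀⟩⟩
  · exact slotAntiConcentration_of_sections μE ζ hG hu fun z => isEmptyElim z
  have hq : 9 * Mq R MQ * b * ε < 1 := lt_one_of_le_half hq2
  have hC₂ : 0 ≤ Mq R MQ := Mq_nonneg_of_Q hR (hQM z₀)
  -- the window and the derivative family of the chart
  have hO : MeasurableSet {y : realSub κY | ‖incl κY y‖ < ε} :=
    measurableSet_lt (incl κY).continuous.norm.measurable measurable_const
  -- S46: the chart data per exterior point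
  have hcd := fun z => realForm_chartData_of_Q hκX hκY hR (hQa z) (hQ0 z) (hQM z) (hQt z) (hLQh z) hb (hHop z)
    (hhop z) hq hRC (hDball z) (hDfix z) (Ψ z) (hΨ z)
  have hΦm : ∀ z, Measurable (Φ z) := fun z => by rw [hΦ z]; exact (hcd z).1
  have hinj : ∀ z, InjOn (Φ z) {y : realSub κY | ‖incl κY y‖ < ε} := fun z => by rw [hΦ z]; exact (hcd z).2.1
  have hΦ' : ∀ z, ∀ y ∈ {y : realSub κY | ‖incl κY y‖ < ε}, HasFDerivWithinAt (Φ z)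
      (ContinuousLinearMap.id ℝ (realSub κY) -
        (reP κY hκY ∘L ((hop z).mkContinuous b (hHop z)).restrictScalars ℝ ∘L incl κX) ∘L
          (reP κX hκX ∘L (fderiv ℂ (Dt z) (incl κY y)).restrictScalars ℝ ∘L incl κY))
      {y : realSub κY | ‖incl κY y‖ < ε} y := fun z => by rw [hΦ z]; exact (hcd z).2.2.1
  -- §1 per exterior point
  have hpos : ∀ z, ∀ y ∈ {y : realSub κY | ‖incl κY y‖ < ε}, 0 < (ContinuousLinearMap.id ℝ (realSub κY) -
      (reP κY hκY ∘L ((hop z).mkContinuous b (hHop z)).restrictScalars ℝ ∘L incl κX) ∘L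
        (reP κX hκX ∘L (fderiv ℂ (Dt z) (incl κY y)).restrictScalars ℝ ∘L incl κY)).det :=
    fun z y hy => det_jacobian_pos_of_Q hκX hκY hR (hQa z) (hQM z) (hQ0 z) hb (hHop z) hq2 hRC (hDball z)
      (hDfix z) (hhop z) (hQt z) hy
  have hdetm := fun z => measurable_det_jacobian hκX hκY (hHop z) (Dt z)
  -- the pulled-back density is measurable
  have hGtm : ∀ z, Measurable fun y : realSub κY => ({y : realSub κY | ‖incl κY y‖ < ε}).indicator
      (fun y => ENNReal.ofReal |(ContinuousLinearMap.id ℝ (realSub κY) -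
        (reP κY hκY ∘L ((hop z).mkContinuous b (hHop z)).restrictScalars ℝ ∘L incl κX) ∘L
          (reP κX hκX ∘L (fderiv ℂ (Dt z) (incl κY y)).restrictScalars ℝ ∘L incl κY)).det| *
        G (Φ z y, z)) y := fun z =>
    ((ENNReal.measurable_ofReal.comp (continuous_abs.measurable.comp (hdetm z))).mul
      (hG.comp ((hΦm z).prodMk measurable_const))).indicator hO
  -- off the support of `Jco`, the window-restricted density through the chart vanishes
  have hJ0 : ∀ z a x, Jco z a x = 0 → ({y : realSub κY | ‖incl κY y‖ < ε}).indicator (fun y => G (Φ z y, z))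
      (σ z a + Ψ z (x, 0)) = 0 := fun z a x h0 => by rw [hFdict z a x, h0, zero_mul]
  -- the charted window sits in the ball of radius `r`
  have hnorm : ∀ z a, ∀ x ∈ W z a, ‖incl κY (σ z a + Ψ z (x, 0))‖ ≤ r := fun z a x hx => by
    rw [norm_incl]
    have h1 : ‖Ψ z (x, 0)‖ ≤ Rad * ‖Ψ z (x, 0)‖ := le_mul_of_one_le_left (norm_nonneg _) hRad.le
    exact (norm_add_le _ _).trans (by linarith [hWr z a x hx])
  refine slotAC_linearizedWindow_of_levelData μE μK Ψ ζ hG hu (fun _ => hO) hΦm hinj hΦ' hGsupp hσm hσ hGtm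
    (fun z y => rfl) (fun z a => ?_) Ttr hN hPu hol hcont Pw Gw
    (fun z a x => 𝓔 z a x + -Real.log (ContinuousLinearMap.id ℝ (realSub κY) -
      (reP κY hκY ∘L ((hop z).mkContinuous b (hHop z)).restrictScalars ℝ ∘L incl κX) ∘L
        (reP κX hκX ∘L (fderiv ℂ (Dt z) (incl κY (σ z a + Ψ z (x, 0)))).restrictScalars ℝ ∘L incl κY)).det)
    W Jco (fun z a x => ?_) (fun z a x hne => ?_) hJW hJ hRad hAN hGW hsw1 hsw0 hlw0 hdw0
    (fun z a x hx c' hc0 hc1 => ?_) ?_ hθ hδ0 hδ1 hρ0 hρ hβ hSM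
  · -- `hfin`: the Jacobian is bounded on the charted window by `exp (dim · L)`
    have hle : (fun x : Kf => ({y : realSub κY | ‖incl κY y‖ < ε}).indicator
        (fun y => ENNReal.ofReal |(ContinuousLinearMap.id ℝ (realSub κY) -
          (reP κY hκY ∘L ((hop z).mkContinuous b (hHop z)).restrictScalars ℝ ∘L incl κX) ∘L
            (reP κX hκX ∘L (fderiv ℂ (Dt z) (incl κY y)).restrictScalars ℝ ∘L incl κY)).det| *
          G (Φ z y, z)) (σ z a + Ψ z (x, 0))) ≤
        fun x => ENNReal.ofReal (Real.exp (Module.finrank ℂ 𝒴 * (-Real.log (1 - 18 * Mq R MQ * b * r)))) *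
          ({y : realSub κY | ‖incl κY y‖ < ε}).indicator (fun y => G (Φ z y, z)) (σ z a + Ψ z (x, 0)) := by
      intro x
      by_cases hpt : σ z a + Ψ z (x, 0) ∈ {y : realSub κY | ‖incl κY y‖ < ε}
      · simp only [indicator_of_mem hpt]
        by_cases hJx : Jco z a x = 0
        · have h0 := hJ0 z a x hJx
          rw [indicator_of_mem hpt] at h0
          simp only [h0, mul_zero, le_refl]
        · refine mul_le_mul' (ENNReal.ofReal_le_ofReal ?_) le_rfl
          rw [abs_of_pos (hpos z _ hpt)]
          exact det_jacobian_le_exp_of_Q hκX hκY hR (hQa z) (hQM z) (hQ0 z) hb (hHop z) hq2 hRC (hDball z)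
            (hDfix z) (hhop z) (hQt z) (hnorm z a x (hJW z a x hJx)) hrε
      · simp only [indicator_of_notMem hpt, mul_zero, le_refl]
    have hfin' := hfin z a
    rw [withDensity_apply _ MeasurableSet.univ, Measure.restrict_univ] at hfin' ⊢
    have h1 := lintegral_mono (μ := μK) hle
    rw [lintegral_const_mul' _ _ ENNReal.ofReal_ne_top] at h1
    exact ne_top_of_le_ne_top (ENNReal.mul_ne_top ENNReal.ofReal_ne_top hfin') h1
  · -- `hFdict` of S33: the Jacobian FOLDED into the weight as the term `𝓔_J`
    by_cases hpt : σ z a + Ψ z (x, 0) ∈ {y : realSub κY | ‖incl κY y‖ < ε}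
    · have hd := hpos z _ hpt
      have e1 := hFdict z a x
      rw [indicator_of_mem hpt] at e1
      rw [indicator_of_mem hpt, abs_of_pos hd, e1, weight_add, neg_neg, Real.exp_log hd]
      ring
    · rw [indicator_of_notMem hpt]
      have e1 := hFdict z a x
      rw [indicator_of_notMem hpt] at e1
      rcases mul_eq_zero.1 e1.symm with h0 | h0
      · rw [h0, zero_mul]
      · exact absurd h0 (by simp only [weight, ENNReal.ofReal_eq_zero, not_le]; exact Real.exp_pos _)
  · -- `hudict` of S33, from the Jacobian-free guard
    refine hudict z a x fun h0 => hne ?_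
    by_cases hpt : σ z a + Ψ z (x, 0) ∈ {y : realSub κY | ‖incl κY y‖ < ε}
    · rw [indicator_of_mem hpt] at h0 ⊢
      rw [h0, mul_zero]
    · rw [indicator_of_notMem hpt]
  · -- `hE` of S33 for `𝓔 + 𝓔_J`: the other terms' binder + S41's theorem for the Jacobian term
    have h1 := hE z a x hx c' hc0 hc1
    have h2 := hE_jacobianTerm_fixed_of_Q hκX hκY hR (hQa z) (hQM z) (hQ0 z) hb (hHop z) hq2 hRC (hDball z)
      (hDfix z) (hhop z) (hQt z)
      (((Ψ z : (Kf × realSub κX) →L[ℝ] realSub κY) ∘L ContinuousLinearMap.inl ℝ Kf (realSub κX)).toLinearMap)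
      (σ z a) hRad (fun x hx => hWr z a x hx) hrε x hx c' hc0 hc1
    have hΛ : ∀ y : Kf, (((Ψ z : (Kf × realSub κX) →L[ℝ] realSub κY) ∘L
        ContinuousLinearMap.inl ℝ Kf (realSub κX)).toLinearMap) y = Ψ z (y, 0) := fun _ => rfl
    simp only [hΛ] at h2
    linarith
  · -- `hB𝓔` of S33
    exact add_nonneg hB𝓔 (hB𝓔_jacobianTerm hC₂ hb hq2 hRad hr0 hrε)

end Summit.QuantumFields.BalabanUV.T4Continuum.ShellMeasureLinearizedEndFromQ

end
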